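import Mathlib
import Literature.MathematicalPhysics.QuantumFieldTheory.Balaban1983to89.Beta.VectorLegVolumeAdapter
import Literature.MathematicalPhysics.QuantumFieldTheory.Balaban1983to89.Beta.EntrywiseVolumeLimit
import Literature.MathematicalPhysics.QuantumFieldTheory.Balaban1983to89.B5RealFields

/-!
# Bałaban β sub-cell, row BETA-an5 (gen 10) — THE INFINITE-VOLUME VECTOR PROPAGATOR `K^∞`:
# the entrywise `T ↗ ℤ^d` limit of `G = Δ_a⁻¹` (B5 (1.71)/(1.83), `U = 1`), named, for ALL entries

HONEST FRAMING (cell rule, verbatim): discharging `BetaPertH` makes Bałaban's UV stability UNCONDITIONAL —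
a real constructive-QFT result; it is NOT the continuum limit and NOT the Clay problem.  This module is
bookkeeping over kernel theorems of this package ([folklore]); it cites NO printed fact as a hypothesis and it
is NOT `BetaPertH`, NOT an (α)/(β) leaf, NOT summit progress.

## What is identified (BETA-SPEC §7.33 (e) «the (D3-vol) K^∞ identification»; WALL.md v1.8 §3 (R13-1), §6 (D3))

The vector road's legs are entries of the covariant propagator `G = Δ_a⁻¹ = B5Prop11Plancherel.calG n hn M a ha`
(Bałaban, *Propagators and renormalization transformations I*, CMP 95 (1984), (1.69)–(1.73) p. 30 and (1.83)
p. 31, at `U = 1`) on the fine torus `T = Π_μ ℤ/(n M_μ)`, read in lattice units (`× n²`,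
`Beta.VectorTailsPt.rdM`).  (R13-1) fixes every leg table as «the limit as `T ↗ ℤ^d`».  Here that limit is
NAMED and PROVED for every entry and every pair of components:

* `Kinf n a : (ℤ^d × {1..d}) → (ℤ^d × {1..d}) → ℝ` (§2), EXPLICIT in the three `ℤ^d`-side objects of this
  lineage — the `ℤ^d` free leg `G₀ = latticeGreen/2` (`Beta.PoissonInterior.G₀`), the Brillouin-zone integral
  `RperpBLim` of the bond-block Woodbury symbol (`Beta.WoodburyBondSymbol`, B5 (1.83) lines 1–2) and the
  Brillouin-zone integral `LkerLim` of the longitudinal symbol (`Beta.LongitudinalSymbol`, B5 (1.83) line 3):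
  `K^∞((x,μ),(x′,ν)) = δ_{μν}·(G₀(x′−x) − n²·Re R⊥_{w_μ,∞}(X, X′)) + n²·Re 𝓛_∞((X,μ),(X′,ν))`,
  `X, X′ ∈ ℕ^d` ANY representatives of `x, x′` up to a common block translation (`Kinf_eq_of_repr`);
* THE LIMIT (§3): along the even cubic volumes `M = cubic d (2(t+1))` of (R13-1) (`BlockKernelVolumeSockets`),
  for every `d ≥ 3`, `n ≥ 1`, `a > 0`, all `x, x′ ∈ ℤ^d`, all `μ, ν`:
  `n²·Re G_T((x̄,μ),(x̄′,ν)) → K^∞((x,μ),(x′,ν))` (`calG_re_tendsto_Kinf`) and, since every entry of `G_T` is real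
  (`calG_im_eq_zero`, from `B5RealFields.isReal_DeltaA_inv`), `n²·G_T((x̄,μ),(x̄′,ν)) → K^∞` in `ℂ`
  (`calG_tendsto_Kinf`) — off-diagonal components included (there the `Γ`-part vanishes and the limit is pure
  line 3, `Kinf_of_ne`);
* STRUCTURE passed to the limit (§4): block-translation covariance with period `n`
  (`Kinf_blockShift`, = `Beta.IsPeriodic₂ n` of `Beta/EntrywiseVolumeLimit` for every component block,
  `isPeriodic₂_Kinf`), symmetry `K^∞(i,j) = K^∞(j,i)` (`Kinf_symm`, from `B5RealFields.GR_transpose` per torus),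
  and the volume-uniform entry bound `|K^∞| ≤ n²/γ₀(d,a)` (`abs_Kinf_le`, from (1.89) `B5RealFields.ineq189R_G`
  per torus: `|G_T(i,j)| ≤ γ₀⁻¹`, `abs_calG_re_le`) — temperedness of `K^∞`;
* THE READING (§5, `d = 4`): the explicit limit family of `Beta/VectorLegVolumeAdapter` IS the displacement
  function of `K^∞`: `GfE a k n (p,ℓ) v = K^∞((p+v, k ℓ),(p, k ℓ)) = Beta.baseFun K^∞_{k ℓ,k ℓ} p v`
  (`GfE_eq_Kinf`, `GfE_eq_baseFun`), so the wall's one-loop binder `hU` of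
  `VectorLegVolumeAdapter.endpointExistence_of_vectorTails_evenVolume` is a statement about the entries of ONE
  named infinite-volume kernel; `GT → K^∞` (`GT_tendsto_Kinf`).

## What is NOT claimed (scope)

`K^∞` is the printed «limit as `T ↗ ℤ^d`» object of (R13-1), obtained on the RIEMANN-SUM road of this lineage
(symbols integrated over the Brillouin zone).  It is NOT asserted here that `K^∞` inverts an infinite-volume
`Δ_a` on `ℤ^d`: `Δ_a = Δ − ∂P∂* + aQ*Q` contains the non-local `P` of B5 (1.70) (through `Δ⁻¹` and
`(Q′Δ⁻²Q′*)⁻¹`), which nobody has typed on `ℤ^d`.  Nor is the method-of-images identity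
`periodise₂ K^∞ = n²G_T` of `Beta/EntrywiseVolumeLimit` asserted — it is FALSE as an absolutely convergent
statement: the rows of `K^∞` are not summable (`K^∞ ~ G₀ ~ c/|x−x′|^{d−2}`), so that module's `RowBound`/`Decay₂`
road applies to decaying REMAINDER kernels (an4), not to the legs themselves.  No bound beyond `|K^∞| ≤ n²/γ₀`
is proved here (the window-grade rows are `VectorLegVolumeAdapter.gamma_row*` and `LongitudinalWindow`).

Depends on: `Beta/VectorLegVolumeAdapter` (an5 gen 9: `GfE`, `GfE_eq_of_repr`, `GT_tendsto_GfE`,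
`castT_natCast_eq_emb`), `Beta/BlockKernelVolumeSockets` (the four sockets, `RperpBLim_blockShift`,
`LkerLim_blockShift`), `Beta/VectorPropagatorDict` (`gammaSum_apply`), `Beta/LongitudinalWindow`
(`calG_sub_gammaSum_apply`), `Beta/VectorTailsPt` (`calG_translate`), `Beta/FreeLegDictionary` (`torusFreeLeg`),
`B5RealFields` (`isReal_DeltaA_inv`, `GR_transpose`, `ineq189R_G`), `B5DeltaA169` (`calG_eq_DeltaA_inv`),
`Beta/EntrywiseVolumeLimit` (vocabulary `Kernel₂`, `IsPeriodic₂`, `baseFun` only).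
-/

noncomputable section

open Filter Topology
open scoped BigOperators Matrix

namespace Literature.MathematicalPhysics.QuantumFieldTheory.Balaban1983to89.Beta.VectorPropagatorLimit

open Literature.MathematicalPhysics.QuantumFieldTheory.Balaban1983to89
open Literature.MathematicalPhysics.QuantumFieldTheory.Balaban1983to89.Beta
open Literature.MathematicalPhysics.QuantumFieldTheory.Balaban1983to89.B5Prop11Plancherel
open Literature.MathematicalPhysics.QuantumFieldTheory.Balaban1983to89.B5Prop11Lattice (gammaZero gammaZero_pos)
open Literature.MathematicalPhysics.QuantumFieldTheory.Balaban1983to89.B5RealFields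
open Literature.MathematicalPhysics.QuantumFieldTheory.Balaban1983to89.B5DeltaA169
open Literature.MathematicalPhysics.QuantumFieldTheory.Balaban1983to89.Beta.DyadicShell (Pt)
open Literature.MathematicalPhysics.QuantumFieldTheory.Balaban1983to89.Beta.GhostTable (gFree)
open Literature.MathematicalPhysics.QuantumFieldTheory.Balaban1983to89.Beta.PoissonInterior (G₀)
open Literature.MathematicalPhysics.QuantumFieldTheory.Balaban1983to89.Beta.VectorTails
open Literature.MathematicalPhysics.QuantumFieldTheory.Balaban1983to89.Beta.WoodburyFibre (GfreePerp)
open Literature.MathematicalPhysics.QuantumFieldTheory.Balaban1983to89.Beta.WoodburyCovariant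
open Literature.MathematicalPhysics.QuantumFieldTheory.Balaban1983to89.Beta.FreeLegDictionary
open Literature.MathematicalPhysics.QuantumFieldTheory.Balaban1983to89.Beta.BlockKernelVolumeSockets
open Literature.MathematicalPhysics.QuantumFieldTheory.Balaban1983to89.Beta.VectorPropagatorDict
open Literature.MathematicalPhysics.QuantumFieldTheory.Balaban1983to89.Beta.LongitudinalWindow (Lker calG_sub_gammaSum_apply)
open Literature.MathematicalPhysics.QuantumFieldTheory.Balaban1983to89.Beta.LongitudinalSymbol (LkerLim)
open Literature.MathematicalPhysics.QuantumFieldTheory.Balaban1983to89.Beta.WoodburyBondSymbol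
open Literature.MathematicalPhysics.QuantumFieldTheory.Balaban1983to89.Beta.VectorTailsPt
open Literature.MathematicalPhysics.QuantumFieldTheory.Balaban1983to89.Beta.VectorTailsBlock
open Literature.MathematicalPhysics.QuantumFieldTheory.Balaban1983to89.Beta.VectorTailsSeam
open Literature.MathematicalPhysics.QuantumFieldTheory.Balaban1983to89.Beta.VectorLegVolumeAdapter

/-! ## §1 Per torus: the three-term entry formula, reality, symmetry and the (1.89) entry bound -/

section Torus

variable {d : ℕ} (n : ℕ) [NeZero n] (hn : 1 ≤ n) (M : Fin d → ℕ) [hM : ∀ μ, NeZero (M μ)] (a : ℝ)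
  (ha : 0 < a)

/-- **THE ENTRIES OF `G = Δ_a⁻¹` IN THREE TERMS** (every torus, every pair of components):
`G((x,μ),(x′,ν)) = δ_{μν}·(G_free,0^⊥(x′−x) + |T|⁻¹a⁻¹ − R⊥_{w_μ}(x,x′)) + 𝓛((x,μ),(x′,ν))`
(`VectorPropagatorDict.gammaSum_apply` + `LongitudinalWindow.calG_sub_gammaSum_apply`).
Context: [Balaban1984PropagatorsI, (1.83) p. 31]. [folklore] -/
theorem calG_apply_eq (x x' : Tor (fine n M)) (μ ν : Fin d) :
    calG n hn M a ha (x, μ) (x', ν)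
      = (if μ = ν then
            GfreePerp n M 0 (x' - x) + ((Fintype.card (Tor (fine n M)) : ℂ))⁻¹ * (1 / (a : ℂ))
              - RperpW n M (wt n M (bondAvg n M μ)) a 0 x x'
          else 0)
        + Lker n hn M a ha x μ x' ν := by
  rw [← calG_sub_gammaSum_apply n hn M a ha, ← gammaSum_apply n M a, Matrix.sub_apply]
  ring

/-- **every entry of `G = Δ_a⁻¹` is real** (`B5RealFields.isReal_DeltaA_inv`, `calG = Δ_a⁻¹`).
Context: [Balaban1984PropagatorsI, p. 17 «Field configurations are real valued functions A defined at bonds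
of the lattice»] (DOCFIX v1.1 after XREAD lit2-g14 D1: the v1 tag «p. 21 “real vector fields”» was a paraphrase).
[folklore] -/
theorem calG_im_eq_zero (i j : Tor (fine n M) × Fin d) : (calG n hn M a ha i j).im = 0 := by
  rw [calG_eq_DeltaA_inv n hn M a ha]
  exact (isReal_DeltaA_inv n M a).im_eq_zero i j

/-- an entry of `G` is the complexification of its real part. [folklore] -/
theorem coe_calG_re (i j : Tor (fine n M) × Fin d) :
    (((calG n hn M a ha i j).re : ℝ) : ℂ) = calG n hn M a ha i j :=
  Complex.ext (by simp) (by simp [calG_im_eq_zero n hn M a ha i j])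

/-- **`G` is symmetric**: `G(i,j) = G(j,i)` (Hermitian and real). Context: [Balaban1984PropagatorsI, Prop. 1.1
p. 33 «symmetric operator»]. [folklore] -/
theorem calG_symm (i j : Tor (fine n M) × Fin d) : calG n hn M a ha i j = calG n hn M a ha j i := by
  have hH := (B5Prop11Lattice.DeltaA_inv_isHermitian n hn M a ha).apply i j
  have hR := isReal_DeltaA_inv n M a j i
  rw [calG_eq_DeltaA_inv n hn M a ha, ← hH]
  exact (starRingEnd_apply _).symm.trans hR

/-- real parts: `Re G(i,j) = Re G(j,i)`. [folklore] -/
theorem calG_re_symm (i j : Tor (fine n M) × Fin d) :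
    (calG n hn M a ha i j).re = (calG n hn M a ha j i).re := by
  rw [calG_symm n hn M a ha i j]

/-- a coordinate is bounded by the Euclidean norm: `|u i| ≤ ‖u‖`. [folklore] -/
theorem abs_apply_le_l2R {m : Type*} [Fintype m] (u : m → ℝ) (i : m) : |u i| ≤ l2R u :=
  Real.abs_le_sqrt (Finset.single_le_sum (f := fun k => u k ^ 2) (fun _ _ => sq_nonneg _)
    (Finset.mem_univ i))

/-- `‖e_j‖ = 1`. [folklore] -/
theorem l2R_single {m : Type*} [Fintype m] [DecidableEq m] (j : m) : l2R (Pi.single j (1 : ℝ)) = 1 := by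
  unfold l2R
  have : (∑ i, (Pi.single j (1 : ℝ) : m → ℝ) i ^ 2) = 1 := by
    rw [Finset.sum_eq_single j]
    · simp
    · intro b _ hb; simp [hb]
    · intro h; exact absurd (Finset.mem_univ j) h
  rw [this, Real.sqrt_one]

/-- **THE (1.89) ENTRY BOUND, UNIFORM IN THE VOLUME**: `|Re G(i,j)| ≤ γ₀(d,a)⁻¹` on every torus
(`B5RealFields.ineq189R_G` on `J = e_j`).  Context: [Balaban1984PropagatorsI, Prop. 1.1 (1.89) p. 33].
[folklore] -/
theorem abs_calG_re_le (i j : Tor (fine n M) × Fin d) :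
    |(calG n hn M a ha i j).re| ≤ (gammaZero d a)⁻¹ := by
  classical
  have h := ineq189R_G n hn M a ha (Pi.single j 1)
  rw [l2R_single, mul_one] at h
  have hcol : (GR n M a *ᵥ Pi.single j 1) i = (calG n hn M a ha i j).re := by
    rw [calG_eq_DeltaA_inv n hn M a ha, Matrix.mulVec_single_one]
    simp [GR]
  calc |(calG n hn M a ha i j).re| = |(GR n M a *ᵥ Pi.single j 1) i| := by rw [hcol]
    _ ≤ l2R (GR n M a *ᵥ Pi.single j 1) := abs_apply_le_l2R _ i
    _ ≤ (gammaZero d a)⁻¹ := h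

/-- the same in lattice units: `|n² Re G(i,j)| ≤ n²/γ₀`. [folklore] -/
theorem abs_sq_mul_calG_re_le (i j : Tor (fine n M) × Fin d) :
    |((n : ℕ) : ℝ) ^ 2 * (calG n hn M a ha i j).re| ≤ ((n : ℕ) : ℝ) ^ 2 * (gammaZero d a)⁻¹ := by
  rw [abs_mul, abs_of_nonneg (by positivity : (0 : ℝ) ≤ ((n : ℕ) : ℝ) ^ 2)]
  exact mul_le_mul_of_nonneg_left (abs_calG_re_le n hn M a ha i j) (by positivity)

end Torus

/-! ## §2 The infinite-volume kernel `K^∞` on `ℤ^d × {1..d}` -/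

section Lattice

variable {d : ℕ}

/-- the common block-translation vector `s_i = |x_i| + |x′_i|` making both sites nonnegative. [folklore] -/
def shv (x x' : Fin d → ℤ) : Fin d → ℤ := fun i => |x i| + |x' i|

/-- the `ℕ`-representative `x + n s` of the OBSERVATION site. [folklore] -/
def repO (n : ℕ) (x x' : Fin d → ℤ) : Fin d → ℕ := fun i => (x i + (n : ℤ) * shv x x' i).toNat

/-- the `ℕ`-representative `x′ + n s` of the SOURCE site. [folklore] -/
def repS (n : ℕ) (x x' : Fin d → ℤ) : Fin d → ℕ := fun i => (x' i + (n : ℤ) * shv x x' i).toNat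

/-- the observation site's representative is nonnegative (`n ≥ 1`). [folklore] -/
theorem repO_nonneg {n : ℕ} (hn : 1 ≤ n) (x x' : Fin d → ℤ) (i : Fin d) :
    0 ≤ x i + (n : ℤ) * shv x x' i := by
  have h1 : (1 : ℤ) ≤ n := by exact_mod_cast hn
  have hz : 0 ≤ shv x x' i := by unfold shv; positivity
  have : shv x x' i ≤ (n : ℤ) * shv x x' i := le_mul_of_one_le_left hz h1
  unfold shv at this ⊢
  nlinarith [le_abs_self (x i), neg_abs_le (x i), abs_nonneg (x' i)]

/-- the source site's representative is nonnegative (`n ≥ 1`). [folklore] -/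
theorem repS_nonneg {n : ℕ} (hn : 1 ≤ n) (x x' : Fin d → ℤ) (i : Fin d) :
    0 ≤ x' i + (n : ℤ) * shv x x' i := by
  have h1 : (1 : ℤ) ≤ n := by exact_mod_cast hn
  have hz : 0 ≤ shv x x' i := by unfold shv; positivity
  have : shv x x' i ≤ (n : ℤ) * shv x x' i := le_mul_of_one_le_left hz h1
  unfold shv at this ⊢
  nlinarith [le_abs_self (x' i), neg_abs_le (x' i), abs_nonneg (x i)]

/-- the observation representative casts back to `x + n s`. [folklore] -/
theorem repO_cast {n : ℕ} (hn : 1 ≤ n) (x x' : Fin d → ℤ) :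
    (fun i => ((repO n x x' i : ℕ) : ℤ)) = x + fun i => (n : ℤ) * shv x x' i := by
  funext i
  simp only [repO, Int.toNat_of_nonneg (repO_nonneg hn x x' i), Pi.add_apply]

/-- the source representative casts back to `x′ + n s`. [folklore] -/
theorem repS_cast {n : ℕ} (hn : 1 ≤ n) (x x' : Fin d → ℤ) :
    (fun i => ((repS n x x' i : ℕ) : ℤ)) = x' + fun i => (n : ℤ) * shv x x' i := by
  funext i
  simp only [repS, Int.toNat_of_nonneg (repS_nonneg hn x x' i), Pi.add_apply]

/-- two `ℕ`-representatives of the same `ℤ^d` site up to block translations have a common upper block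
translate (any dimension; `VectorLegVolumeAdapter.repr_common_shift` is its `d = 4` copy). [folklore] -/
theorem common_shift (n : ℕ) {X Y : Fin d → ℕ} {q w w' : Fin d → ℤ}
    (hX : (fun i => ((X i : ℕ) : ℤ)) = q + fun i => (n : ℤ) * w i)
    (hY : (fun i => ((Y i : ℕ) : ℤ)) = q + fun i => (n : ℤ) * w' i) :
    X + n • (fun i => (w' i - w i).toNat) = Y + n • (fun i => (w i - w' i).toNat) := by
  funext i
  have h1 := congrFun hX i
  have h2 := congrFun hY i
  simp only [Pi.add_apply] at h1 h2
  have key : w i + ((w' i - w i).toNat : ℤ) = w' i + ((w i - w' i).toNat : ℤ) := by omega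
  apply Nat.cast_injective (R := ℤ)
  simp only [Pi.add_apply, Pi.smul_apply, smul_eq_mul, Nat.cast_add, Nat.cast_mul, h1, h2]
  linear_combination (n : ℤ) * key

variable (n : ℕ) [NeZero n] (a : ℝ)

/-- **THE INFINITE-VOLUME VECTOR PROPAGATOR `K^∞` IN LATTICE UNITS** (`U = 1`, scale `n = L^k`, averaging
weight `a`): for `i = (x,μ)`, `j = (x′,ν)` in `ℤ^d × {1..d}`,
`K^∞(i,j) = δ_{μν}·(G₀(x′−x) − n²·Re R⊥_{w_μ,∞}(X,X′)) + n²·Re 𝓛_∞((X,μ),(X′,ν))`, `X = repO n x x′`,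
`X′ = repS n x x′` — the `ℤ^d` free leg, the bond-block Woodbury symbol integral and the longitudinal symbol
integral of this lineage.  It is the entrywise `T ↗ ℤ^d` limit of `n²·G_T` (§3).
Context: [Balaban1984PropagatorsI, (1.83) p. 31; Balaban1987RG1, p. 264 (the limit as `T ↗ ℤ^d`)].
[folklore] -/
def Kinf (i j : (Fin d → ℤ) × Fin d) : ℝ :=
  (if i.2 = j.2 then
      G₀ (j.1 - i.1) - ((n : ℕ) : ℝ) ^ 2 * (RperpBLim n a 0 i.2 (repO n i.1 j.1) (repS n i.1 j.1)).re
    else 0)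
  + ((n : ℕ) : ℝ) ^ 2 * (LkerLim n a (repO n i.1 j.1) i.2 (repS n i.1 j.1) j.2).re

/-- **`K^∞` DOES NOT DEPEND ON THE REPRESENTATIVES**: for ANY `X, X′ ∈ ℕ^d` with `X = x + n w`,
`X′ = x′ + n w` (`w ∈ ℤ^d` common), the defining formula holds with `X, X′`
(`RperpBLim_blockShift`, `LkerLim_blockShift`). [folklore] -/
theorem Kinf_eq_of_repr (hn : 1 ≤ n) (i j : (Fin d → ℤ) × Fin d) {X X' : Fin d → ℕ} {w : Fin d → ℤ}
    (hX : (fun k => ((X k : ℕ) : ℤ)) = i.1 + fun k => (n : ℤ) * w k)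
    (hX' : (fun k => ((X' k : ℕ) : ℤ)) = j.1 + fun k => (n : ℤ) * w k) :
    Kinf n a i j
      = (if i.2 = j.2 then G₀ (j.1 - i.1) - ((n : ℕ) : ℝ) ^ 2 * (RperpBLim n a 0 i.2 X X').re else 0)
        + ((n : ℕ) : ℝ) ^ 2 * (LkerLim n a X i.2 X' j.2).re := by
  have e1 := common_shift n hX (repO_cast hn i.1 j.1)
  have e2 := common_shift n hX' (repS_cast hn i.1 j.1)
  rw [Kinf, ← RperpBLim_blockShift n a 0 i.2 X X' (fun k => (shv i.1 j.1 k - w k).toNat),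
    ← LkerLim_blockShift n a X i.2 X' j.2 (fun k => (shv i.1 j.1 k - w k).toNat), e1, e2,
    RperpBLim_blockShift, LkerLim_blockShift]

/-- **BLOCK-TRANSLATION COVARIANCE**: `K^∞((x+nz,μ),(x′+nz,ν)) = K^∞((x,μ),(x′,ν))`, `z ∈ ℤ^d`. [folklore] -/
theorem Kinf_blockShift (hn : 1 ≤ n) (x x' z : Fin d → ℤ) (μ ν : Fin d) :
    Kinf n a (x + fun k => (n : ℤ) * z k, μ) (x' + fun k => (n : ℤ) * z k, ν) = Kinf n a (x, μ) (x', ν) := by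
  have hX : (fun k => ((repO n x x' k : ℕ) : ℤ)) = (x + fun k => (n : ℤ) * z k) + fun k => (n : ℤ) * (shv x x' k - z k) := by
    rw [repO_cast hn]; funext k; simp only [Pi.add_apply]; ring
  have hX' : (fun k => ((repS n x x' k : ℕ) : ℤ)) = (x' + fun k => (n : ℤ) * z k) + fun k => (n : ℤ) * (shv x x' k - z k) := by
    rw [repS_cast hn]; funext k; simp only [Pi.add_apply]; ring
  rw [Kinf_eq_of_repr n a hn _ _ hX hX', Kinf]
  have e : (x' + fun k => (n : ℤ) * z k) - (x + fun k => (n : ℤ) * z k) = x' - x := by abel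
  simp only [e]

omit [NeZero n] in
/-- off the component diagonal `K^∞` is pure line 3: `K^∞((x,μ),(x′,ν)) = n² Re 𝓛_∞`, `μ ≠ ν`. [folklore] -/
theorem Kinf_of_ne {μ ν : Fin d} (h : μ ≠ ν) (x x' : Fin d → ℤ) :
    Kinf n a (x, μ) (x', ν) = ((n : ℕ) : ℝ) ^ 2 * (LkerLim n a (repO n x x') μ (repS n x x') ν).re := by
  simp [Kinf, h]

/-- `K^∞` in the vocabulary of `Beta/EntrywiseVolumeLimit`: the component block `(μ,ν)` as a `Kernel₂ d`. [folklore] -/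
def KinfBlock (μ ν : Fin d) : Kernel₂ d := fun x x' => Kinf n a (x, μ) (x', ν)

/-- **every component block of `K^∞` is jointly `n`-periodic** (`Beta.IsPeriodic₂ n`). [folklore] -/
theorem isPeriodic₂_KinfBlock (hn : 1 ≤ n) (μ ν : Fin d) : IsPeriodic₂ n (KinfBlock n a μ ν) := by
  intro x y m
  have ex : imageShift n x m = x + fun k => (n : ℤ) * m k := rfl
  have ey : imageShift n y m = y + fun k => (n : ℤ) * m k := rfl
  show Kinf n a (imageShift n x m, μ) (imageShift n y m, ν) = Kinf n a (x, μ) (y, ν)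
  rw [ex, ey]
  exact Kinf_blockShift n a hn x y m μ ν

end Lattice

/-! ## §3 THE LIMIT `n² G_T → K^∞`, entry by entry, along the even cubic volumes -/

section Limit

variable {d : ℕ} (n : ℕ) [NeZero n] (hn : 1 ≤ n) (a : ℝ) (ha : 0 < a)

/-- `castT` of a difference. [folklore] -/
theorem castT_sub (N : Fin d → ℕ) (v w : Fin d → ℤ) : castT N (v - w) = castT N v - castT N w := by
  rw [sub_eq_add_neg, castT_add, castT_neg, ← sub_eq_add_neg]

/-- **PER TORUS, AT INTEGER SITES, IN SOCKET SHAPE**: on `(ℤ/(n m))^d`,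
`n² Re G((x̄,μ),(x̄′,ν)) = δ_{μν}(torusFreeLeg n m a (x′−x) − n² Re R⊥_{w_μ}(X̂, X̂′)) + n² Re 𝓛((X̂,μ),(X̂′,ν))`,
`X = repO n x x′`, `X′ = repS n x x′` (block-translate both sites by `n s`, `VectorTailsPt.calG_translate`).
[folklore] -/
theorem sq_mul_calG_re_eq (m : ℕ) [NeZero m] (x x' : Fin d → ℤ) (μ ν : Fin d) :
    ((n : ℕ) : ℝ) ^ 2 *
        (calG n hn (cubic d m) a ha (castT (fine n (cubic d m)) x, μ) (castT (fine n (cubic d m)) x', ν)).re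
      = (if μ = ν then
            torusFreeLeg n m a (x' - x)
              - ((n : ℕ) : ℝ) ^ 2 *
                (RperpW n (cubic d m) (wt n (cubic d m) (bondAvg n (cubic d m) μ)) a 0
                  (WoodburySymbol.emb n m (repO n x x')) (WoodburySymbol.emb n m (repS n x x'))).re
          else 0)
        + ((n : ℕ) : ℝ) ^ 2 *
          (Lker n hn (cubic d m) a ha (WoodburySymbol.emb n m (repO n x x')) μ
            (WoodburySymbol.emb n m (repS n x x')) ν).re := by
  have hT := castT_blockVec_mem_blockSteps n (cubic d m) (shv x x')
  rw [← calG_translate n hn (cubic d m) a ha hT (castT (fine n (cubic d m)) x)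
    (castT (fine n (cubic d m)) x') μ ν]
  have e1 : castT (fine n (cubic d m)) x + castT (fine n (cubic d m)) (fun k => (n : ℤ) * shv x x' k)
      = WoodburySymbol.emb n m (repO n x x') := by
    rw [← castT_natCast_eq_emb, repO_cast hn, castT_add]
  have e2 : castT (fine n (cubic d m)) x' + castT (fine n (cubic d m)) (fun k => (n : ℤ) * shv x x' k)
      = WoodburySymbol.emb n m (repS n x x') := by
    rw [← castT_natCast_eq_emb, repS_cast hn, castT_add]
  rw [e1, e2, calG_apply_eq]
  have e3 : WoodburySymbol.emb n m (repS n x x') - WoodburySymbol.emb n m (repO n x x')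
      = castT (fine n (cubic d m)) (x' - x) := by
    rw [← e1, ← e2, castT_sub]; abel
  rw [e3]
  have hG : ∀ G : ℂ, (((n : ℂ)) ^ 2 * G).re = ((n : ℕ) : ℝ) ^ 2 * G.re := by
    intro G
    rw [← Complex.ofReal_natCast, ← Complex.ofReal_pow, Complex.re_ofReal_mul]
  have hC : (((Fintype.card (Tor (fine n (cubic d m))) : ℂ))⁻¹ * (1 / (a : ℂ))).re
      = ((Fintype.card (Tor (fine n (cubic d m))) : ℝ))⁻¹ * (1 / a) := by
    rw [← Complex.ofReal_natCast, ← Complex.ofReal_inv, ← Complex.ofReal_one, ← Complex.ofReal_div,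
      ← Complex.ofReal_mul, Complex.ofReal_re]
  by_cases hμν : μ = ν
  · simp only [if_pos hμν, Complex.add_re, Complex.sub_re, torusFreeLeg, castT_eq_proj, hC, mul_add,
      mul_sub, ← hG]
    ring
  · simp only [if_neg hμν, zero_add]

/-- **THE ENTRYWISE VOLUME LIMIT (real form).**  For `d ≥ 3`, `n ≥ 1`, `a > 0`, every `x, x′ ∈ ℤ^d` and every pair
of components `μ, ν`: along the even cubic volumes `(ℤ/(n·2(t+1)))^d`, `t → ∞`,
`n² Re G_T((x̄,μ),(x̄′,ν)) → K^∞((x,μ),(x′,ν))` (free-leg socket + bond-block Woodbury socket + longitudinal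
socket of `Beta/BlockKernelVolumeSockets`).  Context: [Balaban1987RG1, p. 264] (the `T ↗ ℤ^d` limit at fixed
scale); [Balaban1984PropagatorsI, (1.83) p. 31]. [folklore] -/
theorem calG_re_tendsto_Kinf (hd : 3 ≤ d) (x x' : Fin d → ℤ) (μ ν : Fin d) :
    Tendsto (fun t => ((n : ℕ) : ℝ) ^ 2 *
      (calG n hn (cubic d (evenPeriod t)) a ha (castT (fine n (cubic d (evenPeriod t))) x, μ)
        (castT (fine n (cubic d (evenPeriod t))) x', ν)).re) atTop (𝓝 (Kinf n a (x, μ) (x', ν))) := by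
  have hfun := funext fun t => sq_mul_calG_re_eq n hn a ha (evenPeriod t) x x' μ ν
  rw [hfun]
  have hL := (Lker_socket_re n (by omega : 0 < d) hn ha (repO n x x') μ (repS n x x') ν).const_mul
    (((n : ℕ) : ℝ) ^ 2)
  by_cases hμν : μ = ν
  · simp only [if_pos hμν, Kinf]
    refine Tendsto.add (((freeLeg_socket n hd hn ha (x' - x)).sub ?_)) hL
    exact (RperpB_socket_re n hd hn ha le_rfl μ (repO n x x') (repS n x x')).const_mul _
  · simp only [if_neg hμν, Kinf, zero_add]
    exact hL

/-- **THE ENTRYWISE VOLUME LIMIT (complex form)**: `n² G_T((x̄,μ),(x̄′,ν)) → K^∞((x,μ),(x′,ν))` in `ℂ`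
(every entry of `G_T` is real, `calG_im_eq_zero`). [folklore] -/
theorem calG_tendsto_Kinf (hd : 3 ≤ d) (x x' : Fin d → ℤ) (μ ν : Fin d) :
    Tendsto (fun t => ((n : ℕ) : ℂ) ^ 2 *
      calG n hn (cubic d (evenPeriod t)) a ha (castT (fine n (cubic d (evenPeriod t))) x, μ)
        (castT (fine n (cubic d (evenPeriod t))) x', ν)) atTop (𝓝 ((Kinf n a (x, μ) (x', ν) : ℝ) : ℂ)) := by
  have hfun : (fun t => ((n : ℕ) : ℂ) ^ 2 *
      calG n hn (cubic d (evenPeriod t)) a ha (castT (fine n (cubic d (evenPeriod t))) x, μ)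
        (castT (fine n (cubic d (evenPeriod t))) x', ν))
      = fun t => (((((n : ℕ) : ℝ) ^ 2 *
          (calG n hn (cubic d (evenPeriod t)) a ha (castT (fine n (cubic d (evenPeriod t))) x, μ)
            (castT (fine n (cubic d (evenPeriod t))) x', ν)).re : ℝ)) : ℂ) := by
    funext t
    rw [Complex.ofReal_mul, coe_calG_re]
    push_cast
    ring
  rw [hfun]
  exact (Complex.continuous_ofReal.tendsto _).comp (calG_re_tendsto_Kinf n hn a ha hd x x' μ ν)

/-! ## §4 Structure of `K^∞` obtained by passing to the limit -/

include hn ha in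
/-- **`K^∞` IS SYMMETRIC**: `K^∞(i,j) = K^∞(j,i)` (`d ≥ 3`, `n ≥ 1`, `a > 0`). [folklore] -/
theorem Kinf_symm (hd : 3 ≤ d) (i j : (Fin d → ℤ) × Fin d) : Kinf n a i j = Kinf n a j i := by
  obtain ⟨x, μ⟩ := i
  obtain ⟨x', ν⟩ := j
  have h1 := calG_re_tendsto_Kinf n hn a ha hd x x' μ ν
  have h2 := calG_re_tendsto_Kinf n hn a ha hd x' x ν μ
  have hfun : (fun t => ((n : ℕ) : ℝ) ^ 2 *
      (calG n hn (cubic d (evenPeriod t)) a ha (castT (fine n (cubic d (evenPeriod t))) x, μ)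
        (castT (fine n (cubic d (evenPeriod t))) x', ν)).re)
      = fun t => ((n : ℕ) : ℝ) ^ 2 *
      (calG n hn (cubic d (evenPeriod t)) a ha (castT (fine n (cubic d (evenPeriod t))) x', ν)
        (castT (fine n (cubic d (evenPeriod t))) x, μ)).re := by
    funext t; rw [calG_re_symm]
  rw [hfun] at h1
  exact tendsto_nhds_unique h1 h2

include hn ha in
/-- **`K^∞` IS TEMPERED — THE VOLUME-UNIFORM (1.89) BOUND PASSED TO THE LIMIT**: `|K^∞(i,j)| ≤ n²/γ₀(d,a)`
(`d ≥ 3`, `n ≥ 1`, `a > 0`).  Context: [Balaban1984PropagatorsI, Prop. 1.1 (1.89) p. 33]. [folklore] -/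
theorem abs_Kinf_le (hd : 3 ≤ d) (i j : (Fin d → ℤ) × Fin d) :
    |Kinf n a i j| ≤ ((n : ℕ) : ℝ) ^ 2 * (gammaZero d a)⁻¹ := by
  obtain ⟨x, μ⟩ := i
  obtain ⟨x', ν⟩ := j
  have h := (continuous_abs.tendsto _).comp (calG_re_tendsto_Kinf n hn a ha hd x x' μ ν)
  exact le_of_tendsto' h fun t => abs_sq_mul_calG_re_le n hn (cubic d (evenPeriod t)) a ha _ _

include hn ha in
/-- uniform row bound in an4's vocabulary is NOT available (rows of `K^∞` are not summable); what IS available is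
the uniform ENTRY bound, block by block. [folklore] -/
theorem abs_KinfBlock_le (hd : 3 ≤ d) (μ ν : Fin d) (x x' : Fin d → ℤ) :
    |KinfBlock n a μ ν x x'| ≤ ((n : ℕ) : ℝ) ^ 2 * (gammaZero d a)⁻¹ :=
  abs_Kinf_le n hn a ha hd (x, μ) (x', ν)

end Limit

/-! ## §5 `d = 4`: the reading — the wall's explicit limit family `GfE` IS the displacement function of `K^∞` -/

section Reading

variable {L : Type*} (a : ℝ) (ha : 0 < a)

/-- **`GfE a k n (p,ℓ) v = K^∞((p+v, k ℓ),(p, k ℓ))`** (`n ≥ 1`; `VectorLegVolumeAdapter.GfE_eq_of_repr` with the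
representatives of §2; `G₀(−v) = gFree v`). [folklore] -/
theorem GfE_eq_Kinf (k : L → Fin 4) (n : ℕ) [NeZero n] (b : Pt × L) (v : Pt) :
    GfE a k n b v = Kinf n a (b.1 + v, k b.2) (b.1, k b.2) := by
  have h : 0 < n := Nat.pos_of_ne_zero (NeZero.ne n)
  have hX : (fun i => ((repO n (b.1 + v) b.1 i : ℕ) : ℤ)) = b.1 + v + fun i => (n : ℤ) * shv (b.1 + v) b.1 i :=
    repO_cast h (b.1 + v) b.1
  have hX' : (fun i => ((repS n (b.1 + v) b.1 i : ℕ) : ℤ)) = b.1 + fun i => (n : ℤ) * shv (b.1 + v) b.1 i :=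
    repS_cast h (b.1 + v) b.1
  rw [GfE_eq_of_repr a k h b v hX hX', Kinf, if_pos rfl]
  have e : b.1 - (b.1 + v) = -v := by abel
  rw [e, G₀_neg_eq_gFree]
  rfl

/-- the same as functions of the displacement `v`. [folklore] -/
theorem GfE_eq_Kinf_fun (k : L → Fin 4) (n : ℕ) [NeZero n] (b : Pt × L) :
    GfE a k n b = fun v => Kinf n a (b.1 + v, k b.2) (b.1, k b.2) :=
  funext fun v => GfE_eq_Kinf a k n b v

/-- **`GfE` IS an4's DISPLACEMENT FUNCTION `baseFun` OF THE DIAGONAL COMPONENT BLOCK OF `K^∞`**: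
`GfE a k n (p,ℓ) = Beta.baseFun (K^∞_{k ℓ, k ℓ}) p`. [folklore] -/
theorem GfE_eq_baseFun (k : L → Fin 4) (n : ℕ) [NeZero n] (b : Pt × L) :
    GfE a k n b = baseFun (KinfBlock n a (k b.2) (k b.2)) b.1 :=
  GfE_eq_Kinf_fun a k n b

/-- **THE WALL'S KERNEL FAMILY TENDS TO `K^∞`**: at scale `n ≥ 1`, base point `(p,ℓ)`, displacement `v`,
`GT(t) → K^∞((p+v, k ℓ),(p, k ℓ))` as `t → ∞` (`VectorLegVolumeAdapter.GT_tendsto_GfE`, §5).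
Context: [Balaban1987RG1, p. 264]. [folklore] -/
theorem GT_tendsto_Kinf (k : L → Fin 4) (n : ℕ) [NeZero n] (b : Pt × L) (v : Pt) :
    Tendsto (fun t => GT MvE a ha (X₀L MvE) (fun _ b => k b.2) (fun _ b => k b.2)
      Complex.reAddGroupHom n b t v) atTop (𝓝 (Kinf n a (b.1 + v, k b.2) (b.1, k b.2))) := by
  rw [← GfE_eq_Kinf a k n b v]
  exact GT_tendsto_GfE a ha k (Nat.pos_of_ne_zero (NeZero.ne n)) b v

end Reading

end Literature.MathematicalPhysics.QuantumFieldTheory.Balaban1983to89.Beta.VectorPropagatorLimit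

end
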